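import Literature.Computability.QuantumComplexity.HadamardGadgetAsm
import HarnessLib

/-!
# Uniformity of the Hadamard-gadget family, III: blocks, stages and token handlers of the machine

Topic `Literature/Computability/QuantumComplexity`; third of the files proving that the compiled
post-selected IQP family `HGadget.Hop.gadgetFamily F` is uniform (Bremner–Jozsa–Shepherd 2011,
proof of Thm. 1 with Def. 1). Continuing `HadamardGadgetAsm.lean` (registers, printing routines,
the hop layer), this file assembles, as structured stack programs with exact effects on states,

* the stage numerals (`mkStages`: `s1 := s + 1`, `s2 := s + 2` by `incR`; `advance`: `s := s + 2`,
  two more ticks on the unary `s_f + 1`);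
* **the blocks of the micro-operations** (`blockT`, `blockS`, `blockH`, `blockCZ`: the printed texts
  `blockTText`, … — a gate on the current wire of the qubit, two hop layers, and for `H` the phase
  gates `S = TT` around them, cf. `HGadget.Hop.blockN`);
* the token handlers of the gate loop: a numeral bit (pushed, the padding countdown decremented),
  the separator (pad the numeral to `L` bits, commit it to the next wire slot, refill the countdown),
  the four kinds (`H`, `S`, `T`: one block; `CNOT`: the blocks of `H_t`, `CZ_{ct}`, `H_t`) and the
  bad token (cleanup), with their functional models.

The gate loop with its invariant, the prefix and output phases and the `FP` statement follow in the
sequel.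

## References

* M. J. Bremner, R. Jozsa, D. J. Shepherd, Proc. R. Soc. A 467 (2011) 459–472, Def. 1, Thm. 1.
* S. Arora, B. Barak, *Computational Complexity: A Modern Approach*, CUP 2009, §1.3, §6.1.
* D. E. Knuth, *The Art of Computer Programming*, Vol. 2, 3rd ed. 1998, §4.3.1.
-/

namespace Literature.Computability.QuantumComplexity

open _root_.Computability Complexity Complexity.Com Cryptography Thm25Lex
open Thm25Asm (pushList runs_pushList emitRep runs_emitRep incR runs_incR incLoop runs_incLoop clearFlag runs_clearFlag
  IsFlag isFlag_nil isFlag_true isFlag_flag)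

namespace HGadget.Hop

namespace Asm

/-! ### The static environment of the gate loop -/

/-- The registers that stay fixed during the gate loop and the scratch registers that are empty at
every routine boundary: `LU = 1ᴸ`, `NU = 1ᴺ`, `t = t2 = fl = []`. [folklore] -/
structure Env (L N : ℕ) (s : St) : Prop where
  /-- unary `L` -/
  hLU : s.LU = List.replicate L true
  /-- unary `N` -/
  hNU : s.NU = List.replicate N true
  /-- scratch `t` empty -/
  ht : s.t = []
  /-- scratch `t2` empty -/
  ht2 : s.t2 = []
  /-- carry flag empty -/
  hfl : s.fl = []

/-! ### Stage numerals -/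

/-- `s1 := sB + 1`, `s2 := sB + 2` (copies incremented by `incR`). [folklore] -/
def mkStages : Com R :=
  Com.clear .s1 ;; Com.copy .sB .s1 .t .t2 ;; incR .s1 .t .fl ;; Com.clear .s2 ;; Com.copy .s1 .s2 .t .t2 ;; incR .s2 .t .fl

/-- The binary numeral grows by at most one bit per increment. [folklore] -/
theorem length_encodeNat_succ_le (c : ℕ) : (encodeNat (c + 1)).length ≤ (encodeNat c).length + 1 := by
  rw [TokConv.encodeNat_succ_eq_incRes]; exact TokConv.length_incRes_le _ _

/-- **`mkStages`**: from `sB = bin c`, the registers `s1`, `s2` receive `bin (c+1)`, `bin (c+2)`.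
[folklore] -/
theorem runs_mkStages {L N : ℕ} (s : St) (hE : Env L N s) (c : ℕ) (hsB : s.sB = encodeNat c) :
    Runs mkStages s.regs { s with s1 := encodeNat (c + 1), s2 := encodeNat (c + 2) }.regs
      (2 * s.s1.length + 2 * s.s2.length + 40 * (encodeNat c).length + 70) := by
  have h1 := length_encodeNat_succ_le c
  have h2 : (encodeNat (c + 2)).length ≤ (encodeNat (c + 1)).length + 1 := length_encodeNat_succ_le (c + 1)
  have e1 := runs_clear R.s1 s.regs
  rw [St.upd_s1] at e1
  have e2 := runs_copy (a := R.sB) (b := R.s1) (t := R.t) (u := R.t2) (by decide) (by decide) (by decide) (by decide)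
    (by decide) (by decide) ({ s with s1 := [] } : St).regs (by simpa using hE.ht) (by simpa using hE.ht2)
  rw [St.upd_s1] at e2
  simp only [St.regs_sB, St.regs_s1, List.append_nil] at e2
  have e3 := runs_incR (ctr := R.s1) (tmp := R.t) (flg := R.fl) (by decide) (by decide) (by decide) c
    ({ s with s1 := s.sB } : St).regs (by simpa using hsB) (by simpa using hE.ht) (by simpa using hE.hfl)
  rw [St.upd_s1] at e3
  have e4 := runs_clear R.s2 ({ s with s1 := encodeNat (c + 1) } : St).regs
  rw [St.upd_s2] at e4
  have e5 := runs_copy (a := R.s1) (b := R.s2) (t := R.t) (u := R.t2) (by decide) (by decide) (by decide) (by decide)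
    (by decide) (by decide) ({ s with s1 := encodeNat (c + 1), s2 := [] } : St).regs (by simpa using hE.ht) (by simpa using hE.ht2)
  rw [St.upd_s2] at e5
  simp only [St.regs_s1, St.regs_s2, List.append_nil] at e5
  have e6 := runs_incR (ctr := R.s2) (tmp := R.t) (flg := R.fl) (by decide) (by decide) (by decide) (c + 1)
    ({ s with s1 := encodeNat (c + 1), s2 := encodeNat (c + 1) } : St).regs rfl (by simpa using hE.ht) (by simpa using hE.hfl)
  rw [St.upd_s2] at e6
  refine (e1.seq (e2.seq (e3.seq (e4.seq (e5.seq e6))))).of_eq (by rfl) ?_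
  simp only [St.regs_s1, St.regs_s2, hsB]
  omega

/-- `advance`: two more ticks on `sfU`, `sB := s2` (in order, through `t`), new `s1`, `s2`. [folklore] -/
def advance : Com R := pushList .sfU [true, true] ;; Com.clear .sB ;; Com.move .s2 .sB .t ;; mkStages

/-- **`advance`** takes the stage numerals from `c` to `c + 2`. [folklore] -/
theorem runs_advance {L N : ℕ} (s : St) (hE : Env L N s) (c : ℕ) (hsB : s.sB = encodeNat c)
    (hs1 : s.s1 = encodeNat (c + 1)) (hs2 : s.s2 = encodeNat (c + 2)) :
    Runs advance s.regs
      { s with sfU := true :: true :: s.sfU, sB := encodeNat (c + 2), s1 := encodeNat (c + 3), s2 := encodeNat (c + 4) }.regs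
      (60 * (encodeNat c).length + 200) := by
  have h1 := length_encodeNat_succ_le c
  have h2 : (encodeNat (c + 2)).length ≤ (encodeNat (c + 1)).length + 1 := length_encodeNat_succ_le (c + 1)
  have h3 : (encodeNat (c + 3)).length ≤ (encodeNat (c + 2)).length + 1 := length_encodeNat_succ_le (c + 2)
  have e1 := runs_pushList R.sfU [true, true] s.regs
  rw [St.upd_sfU] at e1
  simp only [List.reverse_cons, List.reverse_nil, List.nil_append, List.cons_append, St.regs_sfU] at e1
  have e2 := runs_clear R.sB ({ s with sfU := true :: true :: s.sfU } : St).regs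
  rw [St.upd_sB] at e2
  have e3 := runs_move (a := R.s2) (b := R.sB) (t := R.t) (by decide) (by decide) (by decide)
    ({ s with sfU := true :: true :: s.sfU, sB := [] } : St).regs (by simpa using hE.ht)
  rw [St.upd_s2, St.upd_sB] at e3
  simp only [St.regs_s2, St.regs_sB, List.append_nil] at e3
  have hE' : Env L N ({ s with sfU := true :: true :: s.sfU, sB := s.s2, s2 := [] } : St) :=
    ⟨hE.hLU, hE.hNU, hE.ht, hE.ht2, hE.hfl⟩
  have e4 := runs_mkStages _ hE' (c + 2) (by simpa using hs2)
  refine (e1.seq (e2.seq (e3.seq e4))).of_eq ?_ ?_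
  · simp [hs2]
  · simp only [St.regs_sB, hsB, hs1, hs2, List.length_cons, List.length_nil]
    omega

/-! ### Cost bounds -/

/-- A bound for the cost of a hop layer when the stage numerals have at most `K` bits. [folklore] -/
def hopCost (L N K : ℕ) : ℕ := 15 * L + 10 * N + 10 + N * (29 * L + 20 * K + 47)

/-- The cost of `runs_hopLayer` is within `hopCost`. [folklore] -/
theorem hopLayer_cost_le {L N K iF cU u v : ℕ} (hiF : iF ≤ L) (hcU : cU = 0) (hu : u ≤ K) (hv : v ≤ K) :
    2 * iF + 2 * cU + 13 * L + 6 + (10 * N + 3) + (N * (10 * (L + u) + 10 * (L + v) + 9 * L + 45 + 2) + 1) ≤ hopCost L N K := by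
  unfold hopCost
  have : N * (10 * (L + u) + 10 * (L + v) + 9 * L + 45 + 2) ≤ N * (29 * L + 20 * K + 47) :=
    Nat.mul_le_mul_left _ (by omega)
  omega

/-- A bound for the cost of a block when the wire and stage numerals have at most `K` bits. [folklore] -/
def blockCost (L N K : ℕ) : ℕ := 2 * hopCost L N K + 120 * K + 200

/-! ### The blocks of the micro-operations -/

/-- Printed text of the block of `T` on the wire with `L`-bit numeral `wv` at the stages `u`, `u1`, `u2`.
[cite: BremnerJozsaShepherdPRSA2011, Thm. 1 (proof)] -/
def blockTText (L N : ℕ) (wv u u1 u2 : List Bool) : List Bool :=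
  tText (wv ++ u) ++ hopText L N u u1 ++ hopText L N u1 u2
/-- Printed text of the block of `S`. [cite: BremnerJozsaShepherdPRSA2011, Thm. 1 (proof)] -/
def blockSText (L N : ℕ) (wv u u1 u2 : List Bool) : List Bool :=
  tText (wv ++ u) ++ tText (wv ++ u) ++ hopText L N u u1 ++ hopText L N u1 u2
/-- Printed text of the block of `H` (`S · hop · S · hop · S`). [cite: BremnerJozsaShepherdPRSA2011, Thm. 1 (proof)] -/
def blockHText (L N : ℕ) (wv u u1 u2 : List Bool) : List Bool :=
  tText (wv ++ u) ++ tText (wv ++ u) ++ hopText L N u u1 ++ (tText (wv ++ u1) ++ tText (wv ++ u1)) ++ hopText L N u1 u2 ++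
    (tText (wv ++ u2) ++ tText (wv ++ u2))
/-- Printed text of the block of `CZ` on the wires with `L`-bit numerals `av`, `bv`. [cite: BremnerJozsaShepherdPRSA2011, Thm. 1 (proof)] -/
def blockCZText (L N : ℕ) (av bv u u1 u2 : List Bool) : List Bool :=
  czText (av ++ u) (bv ++ u) ++ hopText L N u u1 ++ hopText L N u1 u2

/-- Block of `T` on the wire whose numeral is in the slot `w`. [cite: BremnerJozsaShepherdPRSA2011, Thm. 1 (proof)] -/
def blockT (w : R) : Com R := emitT [w, .sB] ;; (hopLayer .sB .s1 ;; hopLayer .s1 .s2)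
/-- Block of `S`. [cite: BremnerJozsaShepherdPRSA2011, Thm. 1 (proof)] -/
def blockS (w : R) : Com R := (emitT [w, .sB] ;; emitT [w, .sB]) ;; (hopLayer .sB .s1 ;; hopLayer .s1 .s2)
/-- Block of `H`. [cite: BremnerJozsaShepherdPRSA2011, Thm. 1 (proof)] -/
def blockH (w : R) : Com R :=
  (emitT [w, .sB] ;; emitT [w, .sB]) ;; hopLayer .sB .s1 ;; (emitT [w, .s1] ;; emitT [w, .s1]) ;; hopLayer .s1 .s2 ;;
    (emitT [w, .s2] ;; emitT [w, .s2])
/-- Block of `CZ` on the wires whose numerals are in the slots `a`, `b`. [cite: BremnerJozsaShepherdPRSA2011, Thm. 1 (proof)] -/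
def blockCZ (a b : R) : Com R := emitCZ [a, .sB] [b, .sB] ;; (hopLayer .sB .s1 ;; hopLayer .s1 .s2)

/-- A wire slot: `w1` or `w2`. [folklore] -/
def Slot (w : R) : Prop := w = .w1 ∨ w = .w2

/-- The sizes relevant to a block: counter, slots and stage numerals. [folklore] -/
structure Small (L K : ℕ) (s : St) : Prop where
  /-- the counter has at most `L` bits -/
  hiF : s.iF.length ≤ L
  /-- the countdown is empty -/
  hcU : s.cU = []
  /-- first slot -/
  hw1 : s.w1.length ≤ K
  /-- second slot -/
  hw2 : s.w2.length ≤ K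
  /-- stage `s` -/
  hsB : s.sB.length ≤ K
  /-- stage `s + 1` -/
  hs1 : s.s1.length ≤ K
  /-- stage `s + 2` -/
  hs2 : s.s2.length ≤ K

section Blocks

variable {L N K : ℕ}

/-- Reading a slot. [folklore] -/
theorem Slot.regs_len {w : R} (hw : Slot w) {s : St} (h : Small L K s) : (s.regs w).length ≤ K := by
  rcases hw with rfl | rfl
  exacts [h.hw1, h.hw2]

/-- Slots avoid the working registers of the printing routines. [folklore] -/
theorem Slot.ne {w : R} (hw : Slot w) : w ≠ .o ∧ w ≠ .t ∧ w ≠ .iF ∧ w ≠ .cU ∧ w ≠ .fl := by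
  rcases hw with rfl | rfl <;> decide

/-- A slot is unchanged by the updates of a block. [folklore] -/
theorem Slot.regs_upd {w : R} (hw : Slot w) (s : St) (o iF cU : List Bool) :
    ({ s with o := o, iF := iF, cU := cU } : St).regs w = s.regs w := by
  rcases hw with rfl | rfl <;> rfl

/-- The stage registers are stage registers. [folklore] -/
theorem stageReg_sB : StageReg R.sB := by unfold StageReg; decide
/-- The stage registers are stage registers. [folklore] -/
theorem stageReg_s1 : StageReg R.s1 := by unfold StageReg; decide
/-- The stage registers are stage registers. [folklore] -/
theorem stageReg_s2 : StageReg R.s2 := by unfold StageReg; decide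

/-- `emitT [w, u]` on a state: text and cost. [folklore] -/
theorem runs_emitT_slot {w u : R} (hw : Slot w) (hu : StageReg u) (s : St) (hE : Env L N s) :
    Runs (emitT [w, u]) s.regs { s with o := (tText (s.regs w ++ s.regs u)).reverse ++ s.o }.regs
      (10 * ((s.regs w).length + (s.regs u).length) + 32) := by
  obtain ⟨hwo, hwt, -, -, -⟩ := hw.ne
  obtain ⟨huo, hut, -, -, -⟩ := hu
  refine (runs_emitT (P := [w, u]) (by simp [hwo.symm, huo.symm]) (by simp [hwt.symm, hut.symm]) s hE.ht).of_eq ?_ ?_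
  · simp [cat]
  · simp only [cat_cons, cat_nil, List.append_nil, List.length_append, List.length_cons, List.length_nil]; omega

/-- A slot is unchanged by an update of the body register. [folklore] -/
theorem Slot.regs_o {w : R} (hw : Slot w) (s : St) (o : List Bool) : ({ s with o := o } : St).regs w = s.regs w := by
  rcases hw with rfl | rfl <;> rfl

/-- `emitT [w, u]` twice (the phase gate `S = TT`). [folklore] -/
theorem runs_emitT2_slot {w u : R} (hw : Slot w) (hu : StageReg u) (s : St) (hE : Env L N s) :
    Runs (emitT [w, u] ;; emitT [w, u]) s.regs
      { s with o := (tText (s.regs w ++ s.regs u)).reverse ++ ((tText (s.regs w ++ s.regs u)).reverse ++ s.o) }.regs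
      (2 * (10 * ((s.regs w).length + (s.regs u).length) + 32)) := by
  have huo := hu.1
  have e1 := runs_emitT_slot hw hu s hE
  have e2 := runs_emitT_slot hw hu { s with o := (tText (s.regs w ++ s.regs u)).reverse ++ s.o } ⟨hE.hLU, hE.hNU, hE.ht, hE.ht2, hE.hfl⟩
  simp only [hw.regs_o s, St.regs_o_update _ _ huo] at e2
  exact (e1.seq e2).of_eq (by rfl) (by omega)

/-- Two hop layers in a row (`sB → s1 → s2`): text, final registers and cost. [folklore] -/
theorem runs_hop_hop (s : St) (hE : Env L N s) (hS : Small L K s) :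
    Runs (hopLayer .sB .s1 ;; hopLayer .s1 .s2) s.regs
      { s with o := (hopText L N s.s1 s.s2).reverse ++ ((hopText L N s.sB s.s1).reverse ++ s.o), iF := numF L N, cU := [] }.regs
      (2 * hopCost L N K) := by
  have e1 := runs_hopLayer stageReg_sB stageReg_s1 s L N hE.hLU hE.hNU hE.ht hE.ht2 hE.hfl
  have e2 := runs_hopLayer stageReg_s1 stageReg_s2 { s with o := (hopText L N s.sB s.s1).reverse ++ s.o, iF := numF L N, cU := [] }
    L N hE.hLU hE.hNU hE.ht hE.ht2 hE.hfl
  refine (e1.seq e2).of_eq (by rfl) ?_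
  have c1 := hopLayer_cost_le (N := N) (cU := s.cU.length) hS.hiF (by rw [hS.hcU]; rfl) hS.hsB hS.hs1
  have c2 := hopLayer_cost_le (N := N) (iF := (numF L N).length) (cU := 0) (le_of_eq (length_numF L N)) rfl hS.hs1 hS.hs2
  simp only [St.regs_sB, St.regs_s1, St.regs_s2, List.length_nil] at c1 c2 ⊢
  omega

/-- **Block of `T`.** [cite: BremnerJozsaShepherdPRSA2011, Thm. 1 (proof)] -/
theorem runs_blockT {w : R} (hw : Slot w) (s : St) (hE : Env L N s) (hS : Small L K s) :
    Runs (blockT w) s.regs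
      { s with o := (blockTText L N (s.regs w) s.sB s.s1 s.s2).reverse ++ s.o, iF := numF L N, cU := [] }.regs (blockCost L N K) := by
  have e1 := runs_emitT_slot hw stageReg_sB s hE
  have e2 := runs_hop_hop { s with o := (tText (s.regs w ++ s.regs .sB)).reverse ++ s.o }
    ⟨hE.hLU, hE.hNU, hE.ht, hE.ht2, hE.hfl⟩ ⟨hS.hiF, hS.hcU, hS.hw1, hS.hw2, hS.hsB, hS.hs1, hS.hs2⟩
  refine (e1.seq e2).of_eq ?_ ?_
  · simp [blockTText, List.reverse_append]
  · have := hw.regs_len hS; have := hS.hsB; simp only [St.regs_sB] at *; unfold blockCost; omega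

/-- **Block of `S`.** [cite: BremnerJozsaShepherdPRSA2011, Thm. 1 (proof)] -/
theorem runs_blockS {w : R} (hw : Slot w) (s : St) (hE : Env L N s) (hS : Small L K s) :
    Runs (blockS w) s.regs
      { s with o := (blockSText L N (s.regs w) s.sB s.s1 s.s2).reverse ++ s.o, iF := numF L N, cU := [] }.regs (blockCost L N K) := by
  have e12 := runs_emitT2_slot hw stageReg_sB s hE
  have e3 := runs_hop_hop { s with o := (tText (s.regs w ++ s.regs .sB)).reverse ++ ((tText (s.regs w ++ s.regs .sB)).reverse ++ s.o) }
    ⟨hE.hLU, hE.hNU, hE.ht, hE.ht2, hE.hfl⟩ ⟨hS.hiF, hS.hcU, hS.hw1, hS.hw2, hS.hsB, hS.hs1, hS.hs2⟩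
  refine (e12.seq e3).of_eq ?_ ?_
  · simp [blockSText, List.reverse_append]
  · have := hw.regs_len hS; have := hS.hsB; simp only [St.regs_sB] at *; unfold blockCost; omega

/-- **Block of `CZ`.** [cite: BremnerJozsaShepherdPRSA2011, Thm. 1 (proof)] -/
theorem runs_blockCZ {a b : R} (ha : Slot a) (hb : Slot b) (s : St) (hE : Env L N s) (hS : Small L K s) :
    Runs (blockCZ a b) s.regs
      { s with o := (blockCZText L N (s.regs a) (s.regs b) s.sB s.s1 s.s2).reverse ++ s.o, iF := numF L N, cU := [] }.regs
      (blockCost L N K) := by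
  obtain ⟨hao, hat, -, -, -⟩ := ha.ne
  obtain ⟨hbo, hbt, -, -, -⟩ := hb.ne
  have e1 := runs_emitCZ (P := [a, .sB]) (Q := [b, .sB]) (by simp [hao.symm]) (by simp [hat.symm]) (by simp [hbo.symm]) (by simp [hbt.symm])
    s hE.ht
  simp only [cat_cons, cat_nil, List.append_nil, St.regs_sB] at e1
  have e2 := runs_hop_hop { s with o := (czText (s.regs a ++ s.sB) (s.regs b ++ s.sB)).reverse ++ s.o }
    ⟨hE.hLU, hE.hNU, hE.ht, hE.ht2, hE.hfl⟩ ⟨hS.hiF, hS.hcU, hS.hw1, hS.hw2, hS.hsB, hS.hs1, hS.hs2⟩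
  refine (e1.seq e2).of_eq ?_ ?_
  · simp [blockCZText, List.reverse_append]
  · have := ha.regs_len hS; have := hb.regs_len hS; have := hS.hsB
    simp only [List.length_append, List.length_cons, List.length_nil] at *; unfold blockCost; omega

/-- **Block of `H`.** [cite: BremnerJozsaShepherdPRSA2011, Thm. 1 (proof)] -/
theorem runs_blockH {w : R} (hw : Slot w) (s : St) (hE : Env L N s) (hS : Small L K s) :
    Runs (blockH w) s.regs
      { s with o := (blockHText L N (s.regs w) s.sB s.s1 s.s2).reverse ++ s.o, iF := numF L N, cU := [] }.regs (2 * blockCost L N K) := by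
  have hE' : ∀ (o iF cU : List Bool), Env L N ({ s with o := o, iF := iF, cU := cU } : St) :=
    fun _ _ _ => ⟨hE.hLU, hE.hNU, hE.ht, hE.ht2, hE.hfl⟩
  have hEo : ∀ (o : List Bool), Env L N ({ s with o := o } : St) := fun _ => ⟨hE.hLU, hE.hNU, hE.ht, hE.ht2, hE.hfl⟩
  have hwl := hw.regs_len hS
  -- `TT` at stage `s`, hop, `TT` at stage `s + 1`, hop, `TT` at stage `s + 2`
  have e12 := runs_emitT2_slot hw stageReg_sB s hE
  let o2 := (tText (s.regs w ++ s.sB)).reverse ++ ((tText (s.regs w ++ s.sB)).reverse ++ s.o)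
  have e3 := runs_hopLayer stageReg_sB stageReg_s1 ({ s with o := o2 } : St) L N hE.hLU hE.hNU hE.ht hE.ht2 hE.hfl
  let o3 := (hopText L N s.sB s.s1).reverse ++ o2
  have e45 := runs_emitT2_slot hw stageReg_s1 ({ s with o := o3, iF := numF L N, cU := [] } : St) (hE' _ _ _)
  rw [hw.regs_upd s] at e45
  let o5 := (tText (s.regs w ++ s.s1)).reverse ++ ((tText (s.regs w ++ s.s1)).reverse ++ o3)
  have e6 := runs_hopLayer stageReg_s1 stageReg_s2 ({ s with o := o5, iF := numF L N, cU := [] } : St) L N hE.hLU hE.hNU hE.ht hE.ht2 hE.hfl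
  let o6 := (hopText L N s.s1 s.s2).reverse ++ o5
  have e78 := runs_emitT2_slot hw stageReg_s2 ({ s with o := o6, iF := numF L N, cU := [] } : St) (hE' _ _ _)
  rw [hw.regs_upd s] at e78
  refine (e12.seq (e3.seq (e45.seq (e6.seq e78)))).of_eq ?_ ?_
  · simp [o6, o5, o3, o2, blockHText, List.reverse_append]
  · have c1 := hopLayer_cost_le (N := N) (cU := s.cU.length) hS.hiF (by rw [hS.hcU]; rfl) hS.hsB hS.hs1
    have c2 := hopLayer_cost_le (N := N) (iF := (numF L N).length) (cU := 0) (le_of_eq (length_numF L N)) rfl hS.hs1 hS.hs2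
    have := hS.hsB; have := hS.hs1; have := hS.hs2
    simp only [St.regs_sB, St.regs_s1, St.regs_s2, List.length_nil] at *
    unfold blockCost; omega

end Blocks

/-! ### Token handlers -/

section Handlers

variable {L N K : ℕ}

/-- Handler of a numeral bit: push it on the accumulator, count it off the padding. [folklore] -/
def hBit (d : Bool) : Com R := Com.push .wa d ;; Com.pop .lc Com.skip Com.skip Com.skip

/-- Model of `hBit`. [folklore] -/
def hBitM (d : Bool) (s : St) : St := { s with wa := d :: s.wa, lc := s.lc.tail }

/-- `hBit` runs to its model (the countdown holds ticks). [folklore] -/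
theorem runs_hBit (d : Bool) (s : St) (j : ℕ) (hlc : s.lc = List.replicate j true) :
    Runs (hBit d) s.regs (hBitM d s).regs 3 := by
  have e1 : Runs (Com.push R.wa d) s.regs ({ s with wa := d :: s.wa } : St).regs 1 := (Runs.push _ _ _).of_eq (by rw [St.upd_wa]; rfl) le_rfl
  cases j with
  | zero =>
    have hk : ({ s with wa := d :: s.wa } : St).regs R.lc = [] := by simpa using hlc
    refine (e1.seq (Runs.pop_nil _ _ hk (Runs.skip _))).of_eq ?_ (by omega)
    simp [hBitM, hlc]
  | succ j =>
    have hk : ({ s with wa := d :: s.wa } : St).regs R.lc = true :: List.replicate j true := by simpa [List.replicate_succ] using hlc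
    refine (e1.seq (Runs.pop_true' _ _ hk rfl (Runs.skip _))).of_eq ?_ (by omega)
    rw [St.upd_lc]; simp [hBitM, hlc, List.replicate_succ]

/-- Pad the accumulator with one `0` per remaining tick of the countdown. [folklore] -/
def padLoop : Com R := Com.loop .lc (Com.push .wa false) (Com.push .wa false)

/-- Model of `padLoop`. [folklore] -/
def padM (s : St) : St := { s with wa := List.replicate s.lc.length false ++ s.wa, lc := [] }

/-- `padLoop` runs to its model. [folklore] -/
theorem runs_padLoop : ∀ (w : List Bool) (s : St), s.lc = w → Runs padLoop s.regs (padM s).regs (3 * w.length + 1)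
  | [], s, h => by
    refine (Runs.loop_nil _ _ (show s.regs R.lc = [] from h)).of_eq ?_ (by simp)
    cases s; simp only at h; subst h; rfl
  | b :: w, s, h => by
    have hk : s.regs R.lc = b :: w := h
    have hbody : Runs (Com.push R.wa false) (Function.update s.regs R.lc w) ({ s with wa := false :: s.wa, lc := w } : St).regs 1 :=
      (Runs.push _ _ _).of_eq (by rw [St.upd_lc, St.upd_wa]; rfl) le_rfl
    have hih := runs_padLoop w ({ s with wa := false :: s.wa, lc := w } : St) rfl
    have e : (padM ({ s with wa := false :: s.wa, lc := w } : St)) = padM s := by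
      simp only [padM, h, List.length_cons, List.replicate_succ', List.append_assoc, List.singleton_append]
    rw [e] at hih
    cases b
    · exact (Runs.loop_false hk hbody hih).of_eq rfl (by simp; omega)
    · exact (Runs.loop_true hk hbody hih).of_eq rfl (by simp; omega)

/-- Commit the accumulator (reversed: least significant bit on top) to the next free slot. [folklore] -/
def commit : Com R := ifFlag .f1 (Com.pour .wa .w2) (Com.pour .wa .w1 ;; Com.push .f1 true)

/-- Model of `commit`. [folklore] -/
def commitM (s : St) : St :=
  if s.f1 = [] then { s with wa := [], w1 := s.wa.reverse ++ s.w1, f1 := [true] } else { s with wa := [], w2 := s.wa.reverse ++ s.w2 }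

/-- `commit` runs to its model. [folklore] -/
theorem runs_commit (s : St) (hf : IsFlag s.f1) : Runs commit s.regs (commitM s).regs (3 * s.wa.length + 5) := by
  obtain ⟨b, hb⟩ := hf
  cases b
  · have hk : s.regs R.f1 = flag false := hb
    have hb' : s.f1 = [] := hb
    have e1 := runs_pour (a := R.wa) (b := R.w1) (by decide) s.regs
    rw [St.upd_wa, St.upd_w1] at e1
    have e2 : Runs (Com.push R.f1 true) ({ s with wa := [], w1 := (s.regs R.wa).reverse ++ s.regs R.w1 } : St).regs
        ({ s with wa := [], w1 := s.wa.reverse ++ s.w1, f1 := [true] } : St).regs 1 :=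
      (Runs.push _ _ _).of_eq (by rw [St.upd_f1]; simp [hb']) le_rfl
    refine (runs_ifFlag_false _ hk (e1.seq e2)).of_eq ?_ (by simp)
    simp [commitM, hb']
  · have hk : s.regs R.f1 = flag true := hb
    have hb' : s.f1 = [true] := hb
    have e1 := runs_pour (a := R.wa) (b := R.w2) (by decide) s.regs
    rw [St.upd_wa, St.upd_w2] at e1
    refine (runs_ifFlag_true _ hk e1).of_eq ?_ (by simp)
    simp [commitM, hb']

/-- Refill the countdown from `LU`. [folklore] -/
def refill : Com R := Com.copy .LU .lc .t .t2

/-- `refill` on an empty countdown. [folklore] -/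
theorem runs_refill (s : St) (hE : Env L N s) (hlc : s.lc = []) :
    Runs refill s.regs { s with lc := List.replicate L true }.regs (10 * L + 3) := by
  have e := runs_copy (a := R.LU) (b := R.lc) (t := R.t) (u := R.t2) (by decide) (by decide) (by decide) (by decide) (by decide)
    (by decide) s.regs (by simpa using hE.ht) (by simpa using hE.ht2)
  rw [St.upd_lc] at e
  refine e.of_eq ?_ ?_
  · simp [hlc, hE.hLU]
  · simp [hE.hLU]

/-- **Handler of the separator**: pad the numeral to `L` bits, commit it, refill the countdown.
[folklore] -/
def hSEP : Com R := padLoop ;; commit ;; refill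

/-- Model of `hSEP` (with `L` the length of `LU`). [folklore] -/
def hSEPM (L : ℕ) (s : St) : St := { commitM (padM s) with lc := List.replicate L true }

/-- `hSEP` runs to its model. [folklore] -/
theorem runs_hSEP (s : St) (hE : Env L N s) (hf : IsFlag s.f1) :
    Runs hSEP s.regs (hSEPM L s).regs (3 * s.lc.length + 1 + (3 * (s.lc.length + s.wa.length) + 5) + (10 * L + 3)) := by
  have e1 := runs_padLoop s.lc s rfl
  have e2 := runs_commit (padM s) (by simpa [padM] using hf)
  have hlc : (commitM (padM s)).lc = [] := by unfold commitM padM; split_ifs <;> rfl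
  have hE' : Env L N (commitM (padM s)) := by
    unfold commitM padM; split_ifs <;> exact ⟨hE.hLU, hE.hNU, hE.ht, hE.ht2, hE.hfl⟩
  have e3 := runs_refill _ hE' hlc
  refine (e1.seq (e2.seq e3)).of_eq rfl ?_
  simp only [padM, List.length_append, List.length_replicate]; omega

/-- Clear the accumulator, the slots, the slot flag, and refill the countdown. [folklore] -/
def cleanup : Com R := Com.clear .wa ;; Com.clear .w1 ;; Com.clear .w2 ;; clearFlag .f1 ;; Com.clear .lc ;; refill

/-- Model of `cleanup`. [folklore] -/
def cleanupM (L : ℕ) (s : St) : St := { s with wa := [], w1 := [], w2 := [], f1 := [], lc := List.replicate L true }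

/-- `cleanup` runs to its model. [folklore] -/
theorem runs_cleanup (s : St) (hE : Env L N s) (hf : IsFlag s.f1) :
    Runs cleanup s.regs (cleanupM L s).regs (2 * s.wa.length + 2 * s.w1.length + 2 * s.w2.length + 2 * s.lc.length + 10 * L + 9) := by
  obtain ⟨b, hb⟩ := hf
  have e1 := runs_clear R.wa s.regs
  rw [St.upd_wa] at e1
  have e2 := runs_clear R.w1 ({ s with wa := [] } : St).regs
  rw [St.upd_w1] at e2
  have e3 := runs_clear R.w2 ({ s with wa := [], w1 := [] } : St).regs
  rw [St.upd_w2] at e3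
  have e4 := runs_clearFlag R.f1 ({ s with wa := [], w1 := [], w2 := [] } : St).regs b (by simpa using hb)
  rw [St.upd_f1] at e4
  have e5 := runs_clear R.lc ({ s with wa := [], w1 := [], w2 := [], f1 := [] } : St).regs
  rw [St.upd_lc] at e5
  have e6 := runs_refill ({ s with wa := [], w1 := [], w2 := [], f1 := [], lc := [] } : St) ⟨hE.hLU, hE.hNU, hE.ht, hE.ht2, hE.hfl⟩ rfl
  refine (e1.seq (e2.seq (e3.seq (e4.seq (e5.seq e6))))).of_eq (by rfl) ?_
  simp only [St.regs_wa, St.regs_w1, St.regs_w2, St.regs_lc]; omega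

/-- The stage numerals hold `s`, `s + 1`, `s + 2`. [folklore] -/
structure Stages (c : ℕ) (s : St) : Prop where
  /-- `sB = bin c` -/
  hsB : s.sB = encodeNat c
  /-- `s1 = bin (c + 1)` -/
  hs1 : s.s1 = encodeNat (c + 1)
  /-- `s2 = bin (c + 2)` -/
  hs2 : s.s2 = encodeNat (c + 2)

/-- Model of `advance` on well-formed stages. [folklore] -/
def advM (c : ℕ) (s : St) : St :=
  { s with sfU := true :: true :: s.sfU, sB := encodeNat (c + 2), s1 := encodeNat (c + 3), s2 := encodeNat (c + 4) }

/-- Model of a block followed by `advance` and `cleanup`: body text `txt`. [folklore] -/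
def stepM (L N c : ℕ) (txt : List Bool) (s : St) : St :=
  cleanupM L (advM c { s with o := txt.reverse ++ s.o, iF := numF L N, cU := [] })

/-- Handler of `T`: block on the wire of slot `w1`, advance, cleanup. [cite: BremnerJozsaShepherdPRSA2011, Thm. 1 (proof)] -/
def hT : Com R := blockT .w1 ;; advance ;; cleanup
/-- Handler of `S`. [cite: BremnerJozsaShepherdPRSA2011, Thm. 1 (proof)] -/
def hS : Com R := blockS .w1 ;; advance ;; cleanup
/-- Handler of `H`. [cite: BremnerJozsaShepherdPRSA2011, Thm. 1 (proof)] -/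
def hH : Com R := blockH .w1 ;; advance ;; cleanup
/-- Handler of `CNOT` (control in `w1`, target in `w2`): the blocks of `H_t`, `CZ_{ct}`, `H_t`.
[cite: NielsenChuang2010, §4.3 Ex. 4.17] -/
def hCNOT : Com R := (blockH .w2 ;; advance) ;; ((blockCZ .w1 .w2 ;; advance) ;; (blockH .w2 ;; advance ;; cleanup))

/-- A block, `advance` and `cleanup` in a row, for a block with text `txt` and cost `B`. [folklore] -/
theorem runs_block_advance_cleanup {blk : Com R} {txt : List Bool} {B : ℕ} (s : St) (hE : Env L N s) (hS : Small L K s) {c : ℕ}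
    (hst : Stages c s) (hf : IsFlag s.f1) (hlc : s.lc.length ≤ L)
    (hblk : Runs blk s.regs { s with o := txt.reverse ++ s.o, iF := numF L N, cU := [] }.regs B) :
    Runs (blk ;; advance ;; cleanup) s.regs (stepM L N c txt s).regs (B + (60 * K + 200) + (6 * K + 12 * L + 9 + 2 * s.wa.length)) := by
  have hE1 : Env L N ({ s with o := txt.reverse ++ s.o, iF := numF L N, cU := [] } : St) := ⟨hE.hLU, hE.hNU, hE.ht, hE.ht2, hE.hfl⟩
  have e2 := runs_advance _ hE1 c hst.hsB hst.hs1 hst.hs2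
  have e3 := runs_cleanup (advM c ({ s with o := txt.reverse ++ s.o, iF := numF L N, cU := [] } : St))
    ⟨hE.hLU, hE.hNU, hE.ht, hE.ht2, hE.hfl⟩ (by simpa [advM] using hf)
  refine (hblk.seq (e2.seq e3)).of_eq rfl ?_
  have := hS.hw1; have := hS.hw2; have := hS.hsB
  have hc : (encodeNat c).length ≤ K := by rw [← hst.hsB]; exact hS.hsB
  simp only [advM] at *
  omega

/-! ### The kind handlers run to their models -/

/-- Model of `hT` (stage read off `sB`). [folklore] -/
def hTM (L N : ℕ) (s : St) : St := stepM L N (decodeNat s.sB) (blockTText L N s.w1 s.sB s.s1 s.s2) s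
/-- Model of `hS`. [folklore] -/
def hSM (L N : ℕ) (s : St) : St := stepM L N (decodeNat s.sB) (blockSText L N s.w1 s.sB s.s1 s.s2) s
/-- Model of `hH`. [folklore] -/
def hHM (L N : ℕ) (s : St) : St := stepM L N (decodeNat s.sB) (blockHText L N s.w1 s.sB s.s1 s.s2) s

/-- The text of the `CNOT` handler: `H_t` at stage `c`, `CZ_{ct}` at `c + 2`, `H_t` at `c + 4`.
[cite: NielsenChuang2010, §4.3 Ex. 4.17] -/
def cnotText (L N c : ℕ) (u v : List Bool) : List Bool :=
  blockHText L N v (encodeNat c) (encodeNat (c + 1)) (encodeNat (c + 2)) ++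
    blockCZText L N u v (encodeNat (c + 2)) (encodeNat (c + 3)) (encodeNat (c + 4)) ++
      blockHText L N v (encodeNat (c + 4)) (encodeNat (c + 5)) (encodeNat (c + 6))

/-- The stage registers after the three `advance`s of a `CNOT`. [folklore] -/
def adv3M (c : ℕ) (s : St) : St :=
  { s with sfU := true :: true :: true :: true :: true :: true :: s.sfU, sB := encodeNat (c + 6), s1 := encodeNat (c + 7), s2 := encodeNat (c + 8) }

/-- Model of `hCNOT`. [folklore] -/
def hCNOTM (L N : ℕ) (s : St) : St :=
  cleanupM L (adv3M (decodeNat s.sB) { s with o := (cnotText L N (decodeNat s.sB) s.w1 s.w2).reverse ++ s.o, iF := numF L N, cU := [] })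

/-- A bound for the cost of any handler. [folklore] -/
def handlerCost (L N K : ℕ) : ℕ := 7 * blockCost L N K + 3 * (60 * K + 200) + (8 * K + 12 * L + 20)

/-- The hypotheses of a kind handler: environment, sizes, stages, flag, countdown. [folklore] -/
structure KindPre (L N K c : ℕ) (s : St) : Prop where
  /-- environment -/
  hE : Env L N s
  /-- sizes -/
  hS : Small L K s
  /-- stages -/
  hst : Stages c s
  /-- slot flag -/
  hf : IsFlag s.f1
  /-- countdown within `L` -/
  hlc : s.lc.length ≤ L
  /-- accumulator within `K` -/
  hwa : s.wa.length ≤ K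
  /-- room for the stages of a `CNOT` -/
  hcK : c + 9 ≤ K

/-- **`hT` runs to its model.** [cite: BremnerJozsaShepherdPRSA2011, Thm. 1 (proof)] -/
theorem runs_hT {c : ℕ} (s : St) (h : KindPre L N K c s) : Runs hT s.regs (hTM L N s).regs (handlerCost L N K) := by
  have e := runs_block_advance_cleanup s h.hE h.hS h.hst h.hf h.hlc (runs_blockT (Or.inl rfl) s h.hE h.hS)
  refine e.of_eq ?_ ?_
  · rw [hTM, h.hst.hsB, decode_encodeNat]; rfl
  · have := h.hwa; unfold handlerCost; omega

/-- **`hS` runs to its model.** [cite: BremnerJozsaShepherdPRSA2011, Thm. 1 (proof)] -/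
theorem runs_hS {c : ℕ} (s : St) (h : KindPre L N K c s) : Runs hS s.regs (hSM L N s).regs (handlerCost L N K) := by
  have e := runs_block_advance_cleanup s h.hE h.hS h.hst h.hf h.hlc (runs_blockS (Or.inl rfl) s h.hE h.hS)
  refine e.of_eq ?_ ?_
  · rw [hSM, h.hst.hsB, decode_encodeNat]; rfl
  · have := h.hwa; unfold handlerCost; omega

/-- **`hH` runs to its model.** [cite: BremnerJozsaShepherdPRSA2011, Thm. 1 (proof)] -/
theorem runs_hH {c : ℕ} (s : St) (h : KindPre L N K c s) : Runs hH s.regs (hHM L N s).regs (handlerCost L N K) := by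
  have e := runs_block_advance_cleanup s h.hE h.hS h.hst h.hf h.hlc (runs_blockH (Or.inl rfl) s h.hE h.hS)
  refine e.of_eq ?_ ?_
  · rw [hHM, h.hst.hsB, decode_encodeNat]; rfl
  · have := h.hwa; unfold handlerCost; omega

/-- One block of the `CNOT` handler followed by `advance` (no cleanup): effect and the re-established
hypotheses. [folklore] -/
theorem runs_block_advance {blk : Com R} {txt : List Bool} {B c : ℕ} (s : St) (hE : Env L N s) (hst : Stages c s)
    (hblk : Runs blk s.regs { s with o := txt.reverse ++ s.o, iF := numF L N, cU := [] }.regs B) :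
    Runs (blk ;; advance) s.regs (advM c { s with o := txt.reverse ++ s.o, iF := numF L N, cU := [] }).regs
      (B + (60 * (encodeNat c).length + 200)) := by
  have hE1 : Env L N ({ s with o := txt.reverse ++ s.o, iF := numF L N, cU := [] } : St) := ⟨hE.hLU, hE.hNU, hE.ht, hE.ht2, hE.hfl⟩
  exact (hblk.seq (runs_advance _ hE1 c hst.hsB hst.hs1 hst.hs2)).of_eq rfl le_rfl

/-- After a block and `advance`, the hypotheses hold again two stages on (for `c + 2 + 9 ≤ K`). [folklore] -/
theorem kindPre_advM {c : ℕ} {s : St} (h : KindPre L N K c s) (hc : c + 2 + 9 ≤ K) (o : List Bool) :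
    KindPre L N K (c + 2) (advM c { s with o := o, iF := numF L N, cU := [] }) := by
  have hl : ∀ k, (encodeNat (c + k)).length ≤ c + k := fun k => TokConv.length_encodeNat_le _
  refine ⟨⟨h.hE.hLU, h.hE.hNU, h.hE.ht, h.hE.ht2, h.hE.hfl⟩, ⟨?_, rfl, h.hS.hw1, h.hS.hw2, ?_, ?_, ?_⟩, ⟨rfl, rfl, rfl⟩,
    by simpa [advM] using h.hf, by simpa [advM] using h.hlc, by simpa [advM] using h.hwa, hc⟩
  · simp [advM]
  · show (encodeNat (c + 2)).length ≤ K; have := hl 2; omega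
  · show (encodeNat (c + 3)).length ≤ K; have := hl 3; omega
  · show (encodeNat (c + 4)).length ≤ K; have := hl 4; omega

/-- **`hCNOT` runs to its model.** [cite: NielsenChuang2010, §4.3 Ex. 4.17] -/
theorem runs_hCNOT {c : ℕ} (s : St) (h : KindPre L N K c s) (hc : c + 13 ≤ K) :
    Runs hCNOT s.regs (hCNOTM L N s).regs (handlerCost L N K) := by
  have hl : ∀ k, (encodeNat (c + k)).length ≤ c + k := fun k => TokConv.length_encodeNat_le _
  -- first `H_t`
  have e1 := runs_block_advance s h.hE h.hst (runs_blockH (Or.inr rfl) s h.hE h.hS)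
  have h1 := kindPre_advM h (by omega) ((blockHText L N (s.regs .w2) s.sB s.s1 s.s2).reverse ++ s.o)
  set s1 := advM c ({ s with o := (blockHText L N (s.regs .w2) s.sB s.s1 s.s2).reverse ++ s.o, iF := numF L N, cU := [] } : St) with hs1
  -- `CZ_{ct}`
  have e2 := runs_block_advance s1 h1.hE h1.hst (runs_blockCZ (Or.inl rfl) (Or.inr rfl) s1 h1.hE h1.hS)
  have h2 := kindPre_advM h1 (by omega) ((blockCZText L N (s1.regs .w1) (s1.regs .w2) s1.sB s1.s1 s1.s2).reverse ++ s1.o)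
  let o2 := (blockCZText L N (s1.regs .w1) (s1.regs .w2) s1.sB s1.s1 s1.s2).reverse ++ s1.o
  set s2 := advM (c + 2) ({ s1 with o := o2, iF := numF L N, cU := [] } : St) with hs2
  -- second `H_t`, then cleanup
  have e3 := runs_block_advance_cleanup s2 h2.hE h2.hS h2.hst h2.hf h2.hlc (runs_blockH (Or.inr rfl) s2 h2.hE h2.hS)
  refine (e1.seq (e2.seq e3)).of_eq ?_ ?_
  · simp only [hCNOTM, hs2, hs1, o2, stepM, advM, adv3M, cnotText, h.hst.hsB, h.hst.hs1, h.hst.hs2, decode_encodeNat, St.regs_w1,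
      St.regs_w2, List.reverse_append, List.append_assoc, cleanupM]
  · have := h.hwa; have h2 := hl 2
    have hcl : (encodeNat c).length ≤ K := by have := h.hS.hsB; rwa [h.hst.hsB] at this
    simp only [hs2, hs1, advM, h.hst.hsB] at *
    unfold handlerCost; omega

/-- **The bad token**: `cleanup`. [folklore] -/
theorem runs_hBAD {c : ℕ} (s : St) (h : KindPre L N K c s) : Runs cleanup s.regs (cleanupM L s).regs (handlerCost L N K) := by
  refine (runs_cleanup s h.hE h.hf).of_eq rfl ?_
  have := h.hwa; have := h.hS.hw1; have := h.hS.hw2; have := h.hlc; unfold handlerCost; omega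

end Handlers

end Asm

end HGadget.Hop

end Literature.Computability.QuantumComplexity
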